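import Mathlib
import Literature.AlgebraicGeometry.Resolution.CobordantGame
import Literature.AlgebraicGeometry.Resolution.CobordantChartCoefficients
import Literature.AlgebraicGeometry.Resolution.CobordantTupleGame
import Literature.AlgebraicGeometry.Resolution.FormalCoordinateChange
import Summits.ResolutionOfSingularities.ResolutionOfSingularities.Theorems.WeightedInvariantLocalWeightedDropMonicPointBlowup
import Summits.ResolutionOfSingularities.ResolutionOfSingularities.Theorems.WeightedInvariantLocalWeightedDropWildMonicTerminalMoves
import Summits.ResolutionOfSingularities.ResolutionOfSingularities.Theorems.WeightedInvariantLocalWeightedDropWildMonicTerminalCurve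

/-!
# `WeightedInvariant.LocalWeightedDrop`, line `hasse-ridge-face-selection`: the POINT STEP of the monomial terminal class
# (scaled vertex `(a,b)/N` with `a, b < N < a + b`: blow up the origin)

Crux item stmt-ResolutionOfSingularities-8899 `LocalWeightedDrop` (route `ResolutionOfSingularities/WeightedInvariant`), engine of
the door `HypersurfaceCentreConstruction` stmt-ResolutionOfSingularities-19897.  [OURS · L1 W4.3, chain w43, res-type-083 (extra
seat S3ρ, CHAIN v4.3 D12): §1 (T) of `L/res-type-083/S3RHO-DESIGN.md`.  Not a statement of any manuscript.]

`termMono_pointStep`: in the monomial class with data `(N, a, b)`, `a < N`, `b < N` (so `a + b > N` for a position), the point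
blow-up (brick `won_monic_of_pointBlowup`) has: at the AXIS points `(c₀, 0)` / `(0, c₁)` singular successors in the class with data
`(N, a + b - N, b)` / `(N, a + b - N, a)` (support map `α ↦ (|α| - q, α₁)` resp. swapped, `WildMonic.coeff_pointSucc_axis₀/₁`), of
smaller `a + b`, handled by `won_succ_of_termMono`; OFF the axes the vertex coefficient `x^{β₀} · U` becomes `s^{|β₀| - (d-j₀)}` times
a unit (`WildMonic.order_pointSucc_le_of_monomialUnit`), so the successor has order `< d` (as `a + b < 2N`).
-/

set_option linter.dupNamespace false -- mandated namespace of this single-conjunct summit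

namespace Summit.ResolutionOfSingularities.ResolutionOfSingularities.Theorems

open Literature.AlgebraicGeometry.Resolution
open Literature.AlgebraicGeometry.Resolution.CobordantGame

namespace WildMonic

open MvPowerSeries WildTerminal

variable {k : Type} [Field k]

/-- Linear bookkeeping of the scaled exponents under the axis point step. -/
theorem arith_pointStep (q N a b s β0 β1 m : ℕ) (hs : a + b = N + s) (hm : β0 + q = β1 + m) (h0 : q * a ≤ N * β1)
    (h1 : q * b ≤ N * m) : q * s ≤ N * β0 := by
  have e1 : q * a + q * b = q * N + q * s := by rw [← Nat.mul_add, hs, Nat.mul_add]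
  have e2 : N * β0 + N * q = N * β1 + N * m := by rw [← Nat.mul_add, hm, Nat.mul_add]
  have e3 : q * N = N * q := Nat.mul_comm _ _
  omega

/-- A coefficient all of whose monomials dominate `x^{β₀}`, with `[x^{β₀}] ≠ 0`, is `x₀^{β₀ 0} x₁^{β₀ 1}` times a unit. -/
theorem exists_monomialUnit_of_coeff (T : MvPowerSeries (Fin 2) k) (β₀ : Fin 2 →₀ ℕ) (hne : coeff β₀ T ≠ 0)
    (h : ∀ β : Fin 2 →₀ ℕ, coeff β T ≠ 0 → β₀ 0 ≤ β 0 ∧ β₀ 1 ≤ β 1) :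
    ∃ U : MvPowerSeries (Fin 2) k, constantCoeff U ≠ 0 ∧ T = X 0 ^ (β₀ 0) * X 1 ^ (β₀ 1) * U := by
  obtain ⟨T₁, hT₁⟩ := exists_eq_X_pow_mul_of_coeff 0 (β₀ 0) T fun β hβ => (h β hβ).1
  have hc₁ : ∀ γ : Fin 2 →₀ ℕ, coeff γ T₁ = coeff (γ + Finsupp.single 0 (β₀ 0)) T := fun γ => by
    rw [hT₁, coeff_add_single_X_pow_mul']
  obtain ⟨U, hU⟩ := exists_eq_X_pow_mul_of_coeff 1 (β₀ 1) T₁ fun γ hγ => by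
    rw [hc₁] at hγ
    have := (h _ hγ).2
    simpa using this
  have hcU : ∀ γ : Fin 2 →₀ ℕ, coeff γ U = coeff (γ + Finsupp.single 1 (β₀ 1)) T₁ := fun γ => by
    rw [hU, coeff_add_single_X_pow_mul']
  refine ⟨U, ?_, by rw [hT₁, hU, mul_assoc]⟩
  rw [← coeff_zero_eq_constantCoeff_apply, hcU, hc₁, zero_add]
  have hβ : Finsupp.single 1 (β₀ 1) + Finsupp.single 0 (β₀ 0) = β₀ := by rw [add_comm, ← finsupp_two_eq]
  rw [hβ]; exact hne

/-- THE POINT STEP OF THE MONOMIAL CLASS (`a < N`, `b < N`; see the module docstring). -/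
theorem termMono_pointStep (p : ℕ) (hp : p.Prime) (k : Type) [Field k] [CharP k p] [IsAlgClosed k] {d : ℕ} (hd : 0 < d)
    (hord : ∀ g : MvPowerSeries (Fin 3) k, CobordantGame.IsSingular k g → g.order < d → CobordantGame.Won k 3 g)
    (haxis : ∀ g : MvPowerSeries (Fin 3) k, CobordantGame.IsSingular k g → g.order = d →
      (∃ c : Fin 3 → k, c ≠ 0 ∧ ∀ v : Fin 3 → k,
        CobordantChart.initEval (fun _ : Fin 3 => 1) (v + c) d g = CobordantChart.initEval (fun _ : Fin 3 => 1) v d g) →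
      (∀ c₁ c₂ : Fin 3 → k,
        (∀ v : Fin 3 → k, CobordantChart.initEval (fun _ : Fin 3 => 1) (v + c₁) d g =
          CobordantChart.initEval (fun _ : Fin 3 => 1) v d g) →
        (∀ v : Fin 3 → k, CobordantChart.initEval (fun _ : Fin 3 => 1) (v + c₂) d g =
          CobordantChart.initEval (fun _ : Fin 3 => 1) v d g) →
        ∃ α β : k, (α ≠ 0 ∨ β ≠ 0) ∧ α • c₁ + β • c₂ = 0) →
      CobordantGame.Won k 3 g)
    (N : ℕ) (hN : 0 < N) (r : ℕ)
    (ih : ∀ a b : ℕ, a + b < r → ∀ A : Fin d → MvPowerSeries (Fin 2) k,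
      (∀ j : Fin d, ((d - (j : ℕ) : ℕ) : ℕ∞) < (A j).order) →
      (∀ (j : Fin d) (β : Fin 2 →₀ ℕ), coeff β (A j) ≠ 0 → (d - (j : ℕ)) * a ≤ N * β 0 ∧ (d - (j : ℕ)) * b ≤ N * β 1) →
      (∃ (j₀ : Fin d) (β : Fin 2 →₀ ℕ), N * β 0 = (d - (j₀ : ℕ)) * a ∧ N * β 1 = (d - (j₀ : ℕ)) * b ∧ coeff β (A j₀) ≠ 0) →
      (N ∣ a → N ∣ b → ∀ μ : k, ∃ j : Fin d,
        coeff (Finsupp.single 0 ((d - (j : ℕ)) * a / N) + Finsupp.single 1 ((d - (j : ℕ)) * b / N)) (A j) ≠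
          (d.choose (j : ℕ) : k) * (-μ) ^ (d - (j : ℕ))) →
      CobordantGame.Won k (2 + 1) ((X (Fin.last 2) : MvPowerSeries (Fin (2 + 1)) k) ^ d +
        ∑ j : Fin d, rename (Fin.succAboveEmb (Fin.last 2)) (A j) * X (Fin.last 2) ^ (j : ℕ)))
    (a b : ℕ) (ha : a < N) (hb : b < N) (hr : a + b = r) (A : Fin d → MvPowerSeries (Fin 2) k)
    (hA : ∀ j : Fin d, ((d - (j : ℕ) : ℕ) : ℕ∞) < (A j).order)
    (hM1 : ∀ (j : Fin d) (β : Fin 2 →₀ ℕ), coeff β (A j) ≠ 0 → (d - (j : ℕ)) * a ≤ N * β 0 ∧ (d - (j : ℕ)) * b ≤ N * β 1)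
    (hM2 : ∃ (j₀ : Fin d) (β : Fin 2 →₀ ℕ), N * β 0 = (d - (j₀ : ℕ)) * a ∧ N * β 1 = (d - (j₀ : ℕ)) * b ∧ coeff β (A j₀) ≠ 0)
    (hM3 : N ∣ a → N ∣ b → ∀ μ : k, ∃ j : Fin d,
      coeff (Finsupp.single 0 ((d - (j : ℕ)) * a / N) + Finsupp.single 1 ((d - (j : ℕ)) * b / N)) (A j) ≠
        (d.choose (j : ℕ) : k) * (-μ) ^ (d - (j : ℕ))) :
    CobordantGame.Won k (2 + 1) ((X (Fin.last 2) : MvPowerSeries (Fin (2 + 1)) k) ^ d +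
      ∑ j : Fin d, rename (Fin.succAboveEmb (Fin.last 2)) (A j) * X (Fin.last 2) ^ (j : ℕ)) := by
  classical
  obtain ⟨j₀, β₀, h0, h1, hne⟩ := hM2
  -- the vertex monomial has degree `> d - j₀`, hence `a + b > N`
  have hdeg₀ : d - (j₀ : ℕ) < β₀ 0 + β₀ 1 := by
    have hle := order_le (f := A j₀) hne
    rw [degree_fin_two] at hle
    exact_mod_cast lt_of_lt_of_le (hA j₀) hle
  have habN : N < a + b := by
    have h : N * (d - (j₀ : ℕ)) < N * (β₀ 0 + β₀ 1) := Nat.mul_lt_mul_of_pos_left hdeg₀ hN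
    rw [Nat.mul_add, h0, h1, ← Nat.mul_add, Nat.mul_comm] at h
    exact Nat.lt_of_mul_lt_mul_left h
  obtain ⟨s, hs⟩ := Nat.exists_eq_add_of_le habN.le
  refine won_monic_of_pointBlowup p hp k 2 d hd A hA fun c i₀ hci₀ Bv hBv hSs => ?_
  have hi : i₀ = 0 ∨ i₀ = 1 := by fin_cases i₀ <;> simp
  by_cases hc0 : c 0 = 0
  · -- axis point `(0, c₁)`, live slot `1`: new data `(N, s, a)`
    obtain rfl : i₀ = 1 := by
      rcases hi with h | h
      · exact absurd (by rw [h]; exact hc0) hci₀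
      · exact h
    have hcoef : ∀ (j : Fin d) (β : Fin 2 →₀ ℕ), coeff β (TupleGame.slice (1 : Fin 2) (X 0 * Bv j)) =
        if β 1 ≤ β 0 + (d - (j : ℕ)) then c 1 ^ (β 0 + (d - (j : ℕ)) - β 1) *
          coeff (Finsupp.single 0 (β 1) + Finsupp.single 1 (β 0 + (d - (j : ℕ)) - β 1)) (A j) else 0 :=
      fun j β => coeff_pointSucc_axis₁ c hc0 (A j) (Bv j) (hBv j) β
    refine won_succ_of_termMono p hp k hd hord haxis N hN r ih s a (by omega) _ ?_ ?_ ?_ hSs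
    · intro j β hβ
      rw [hcoef] at hβ
      split_ifs at hβ with hle
      · obtain ⟨h0', h1'⟩ := hM1 j _ (mul_ne_zero_iff.mp hβ).2
        rw [pair_apply_zero] at h0'
        rw [pair_apply_one] at h1'
        obtain ⟨m, hm⟩ := Nat.exists_eq_add_of_le hle
        rw [show β 0 + (d - (j : ℕ)) - β 1 = m by omega] at h1'
        exact ⟨arith_pointStep _ N a b s (β 0) (β 1) m hs hm h0' h1', h0'⟩
      · exact absurd rfl hβ
    · refine ⟨j₀, Finsupp.single 0 (β₀ 0 + β₀ 1 - (d - (j₀ : ℕ))) + Finsupp.single 1 (β₀ 0), ?_, ?_, ?_⟩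
      · rw [pair_apply_zero]
        have e : N * (β₀ 0 + β₀ 1) = (d - (j₀ : ℕ)) * N + (d - (j₀ : ℕ)) * s := by
          rw [Nat.mul_add, h0, h1, ← Nat.mul_add, hs, Nat.mul_add]
        have e2 : N * (β₀ 0 + β₀ 1 - (d - (j₀ : ℕ))) = N * (β₀ 0 + β₀ 1) - N * (d - (j₀ : ℕ)) := Nat.mul_sub _ _ _
        rw [e2, e, Nat.mul_comm N (d - (j₀ : ℕ)), Nat.add_sub_cancel_left]
      · rw [pair_apply_one]; exact h0
      · rw [hcoef, pair_apply_zero, pair_apply_one,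
          if_pos (by omega), show β₀ 0 + β₀ 1 - (d - (j₀ : ℕ)) + (d - (j₀ : ℕ)) - β₀ 0 = β₀ 1 by omega,
          ← finsupp_two_eq]
        exact mul_ne_zero (pow_ne_zero _ hci₀) hne
    · intro hNs hNa
      have hNab : N ∣ a + b := by rw [hs]; exact dvd_add (dvd_refl N) hNs
      have hNb : N ∣ b := (Nat.dvd_add_right hNa).mp hNab
      obtain ⟨s', hs'⟩ := hNs
      obtain ⟨a', ha'⟩ := hNa
      obtain ⟨b', hb'⟩ := hNb
      have hrel : a' + b' = 1 + s' := by
        apply Nat.eq_of_mul_eq_mul_left hN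
        rw [Nat.mul_add, ← ha', ← hb', hs, hs', Nat.mul_add, mul_one]
      refine vertexTest_transport hci₀ b' _ _ (fun j => ?_) (hM3 ⟨a', ha'⟩ ⟨b', hb'⟩)
      rw [hcoef]
      have e1 : (d - (j : ℕ)) * s / N = (d - (j : ℕ)) * s' := by rw [hs', scaled_div N _ _ hN]
      have e2 : (d - (j : ℕ)) * a / N = (d - (j : ℕ)) * a' := by rw [ha', scaled_div N _ _ hN]
      have e3 : (d - (j : ℕ)) * b / N = (d - (j : ℕ)) * b' := by rw [hb', scaled_div N _ _ hN]
      rw [pair_apply_zero, pair_apply_one, e1, e2, e3]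
      have e4 : (d - (j : ℕ)) * s' + (d - (j : ℕ)) - (d - (j : ℕ)) * a' = (d - (j : ℕ)) * b' := by
        have : (d - (j : ℕ)) * a' + (d - (j : ℕ)) * b' = (d - (j : ℕ)) + (d - (j : ℕ)) * s' := by
          rw [← Nat.mul_add, hrel, Nat.mul_add, mul_one]
        omega
      have hcond : (d - (j : ℕ)) * a' ≤ (d - (j : ℕ)) * s' + (d - (j : ℕ)) := by
        have : (d - (j : ℕ)) * a' + (d - (j : ℕ)) * b' = (d - (j : ℕ)) + (d - (j : ℕ)) * s' := by
          rw [← Nat.mul_add, hrel, Nat.mul_add, mul_one]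
        omega
      rw [if_pos hcond, e4]
  by_cases hc1 : c 1 = 0
  · -- axis point `(c₀, 0)`, live slot `0`: new data `(N, s, b)`
    obtain rfl : i₀ = 0 := by
      rcases hi with h | h
      · exact h
      · exact absurd (by rw [h]; exact hc1) hci₀
    have hcoef : ∀ (j : Fin d) (β : Fin 2 →₀ ℕ), coeff β (TupleGame.slice (0 : Fin 2) (X 0 * Bv j)) =
        if β 1 ≤ β 0 + (d - (j : ℕ)) then c 0 ^ (β 0 + (d - (j : ℕ)) - β 1) *
          coeff (Finsupp.single 0 (β 0 + (d - (j : ℕ)) - β 1) + Finsupp.single 1 (β 1)) (A j) else 0 :=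
      fun j β => coeff_pointSucc_axis₀ c hc1 (A j) (Bv j) (hBv j) β
    refine won_succ_of_termMono p hp k hd hord haxis N hN r ih s b (by omega) _ ?_ ?_ ?_ hSs
    · intro j β hβ
      rw [hcoef] at hβ
      split_ifs at hβ with hle
      · obtain ⟨h0', h1'⟩ := hM1 j _ (mul_ne_zero_iff.mp hβ).2
        rw [pair_apply_zero] at h0'
        rw [pair_apply_one] at h1'
        obtain ⟨m, hm⟩ := Nat.exists_eq_add_of_le hle
        rw [show β 0 + (d - (j : ℕ)) - β 1 = m by omega] at h0'
        exact ⟨arith_pointStep _ N b a s (β 0) (β 1) m (by omega) hm h1' h0', h1'⟩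
      · exact absurd rfl hβ
    · refine ⟨j₀, Finsupp.single 0 (β₀ 0 + β₀ 1 - (d - (j₀ : ℕ))) + Finsupp.single 1 (β₀ 1), ?_, ?_, ?_⟩
      · rw [pair_apply_zero]
        have e : N * (β₀ 0 + β₀ 1) = (d - (j₀ : ℕ)) * N + (d - (j₀ : ℕ)) * s := by
          rw [Nat.mul_add, h0, h1, ← Nat.mul_add, hs, Nat.mul_add]
        have e2 : N * (β₀ 0 + β₀ 1 - (d - (j₀ : ℕ))) = N * (β₀ 0 + β₀ 1) - N * (d - (j₀ : ℕ)) := Nat.mul_sub _ _ _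
        rw [e2, e, Nat.mul_comm N (d - (j₀ : ℕ)), Nat.add_sub_cancel_left]
      · rw [pair_apply_one]; exact h1
      · rw [hcoef, pair_apply_zero, pair_apply_one,
          if_pos (by omega), show β₀ 0 + β₀ 1 - (d - (j₀ : ℕ)) + (d - (j₀ : ℕ)) - β₀ 1 = β₀ 0 by omega,
          ← finsupp_two_eq]
        exact mul_ne_zero (pow_ne_zero _ hci₀) hne
    · intro hNs hNb
      have hNab : N ∣ a + b := by rw [hs]; exact dvd_add (dvd_refl N) hNs
      have hNa : N ∣ a := (Nat.dvd_add_left hNb).mp hNab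
      obtain ⟨s', hs'⟩ := hNs
      obtain ⟨a', ha'⟩ := hNa
      obtain ⟨b', hb'⟩ := hNb
      have hrel : a' + b' = 1 + s' := by
        apply Nat.eq_of_mul_eq_mul_left hN
        rw [Nat.mul_add, ← ha', ← hb', hs, hs', Nat.mul_add, mul_one]
      refine vertexTest_transport hci₀ a' _ _ (fun j => ?_) (hM3 ⟨a', ha'⟩ ⟨b', hb'⟩)
      rw [hcoef]
      have e1 : (d - (j : ℕ)) * s / N = (d - (j : ℕ)) * s' := by rw [hs', scaled_div N _ _ hN]
      have e2 : (d - (j : ℕ)) * a / N = (d - (j : ℕ)) * a' := by rw [ha', scaled_div N _ _ hN]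
      have e3 : (d - (j : ℕ)) * b / N = (d - (j : ℕ)) * b' := by rw [hb', scaled_div N _ _ hN]
      rw [pair_apply_zero, pair_apply_one, e1, e2, e3]
      have e4 : (d - (j : ℕ)) * s' + (d - (j : ℕ)) - (d - (j : ℕ)) * b' = (d - (j : ℕ)) * a' := by
        have : (d - (j : ℕ)) * a' + (d - (j : ℕ)) * b' = (d - (j : ℕ)) + (d - (j : ℕ)) * s' := by
          rw [← Nat.mul_add, hrel, Nat.mul_add, mul_one]
        omega
      have hcond : (d - (j : ℕ)) * b' ≤ (d - (j : ℕ)) * s' + (d - (j : ℕ)) := by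
        have : (d - (j : ℕ)) * a' + (d - (j : ℕ)) * b' = (d - (j : ℕ)) + (d - (j : ℕ)) * s' := by
          rw [← Nat.mul_add, hrel, Nat.mul_add, mul_one]
        omega
      rw [if_pos hcond, e4]
  · -- both coordinates non-zero: the vertex coefficient drops the order below `d`
    have hvert : ∀ β : Fin 2 →₀ ℕ, coeff β (A j₀) ≠ 0 → β₀ 0 ≤ β 0 ∧ β₀ 1 ≤ β 1 := by
      intro β hβ
      obtain ⟨h0', h1'⟩ := hM1 j₀ β hβ
      rw [← h0] at h0'; rw [← h1] at h1'
      exact ⟨Nat.le_of_mul_le_mul_left h0' hN, Nat.le_of_mul_le_mul_left h1' hN⟩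
    obtain ⟨U, hU0, hAU⟩ := exists_monomialUnit_of_coeff (A j₀) β₀ hne hvert
    have hq : 0 < d - (j₀ : ℕ) := by have := j₀.2; omega
    have hBv₀ := hBv j₀
    rw [hAU] at hBv₀
    have hle := order_pointSucc_le_of_monomialUnit hq hdeg₀ c hc0 hc1 U hU0 (Bv j₀) hBv₀ i₀
    -- `|β₀| - (d - j₀) + j₀ < d` because `a + b < 2N`
    have hsmall : β₀ 0 + β₀ 1 - (d - (j₀ : ℕ)) + (j₀ : ℕ) < d := by
      have h2 : (d - (j₀ : ℕ)) * (a + b) < (d - (j₀ : ℕ)) * (N + N) := Nat.mul_lt_mul_of_pos_left (by omega) hq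
      have h3 : N * (β₀ 0 + β₀ 1) < N * (2 * (d - (j₀ : ℕ))) := by
        rw [Nat.mul_add, h0, h1, ← Nat.mul_add]
        calc (d - (j₀ : ℕ)) * (a + b) < (d - (j₀ : ℕ)) * (N + N) := h2
          _ = N * (2 * (d - (j₀ : ℕ))) := by ring
      have := Nat.lt_of_mul_lt_mul_left h3
      have hj := j₀.2
      omega
    obtain ⟨γ, hγ, hγne⟩ := exists_coeff_ne_zero_of_order_lt
      (lt_of_le_of_lt hle (by exact_mod_cast Nat.lt_succ_self _) :
        (TupleGame.slice i₀ (X 0 * Bv j₀)).order < ((β₀ 0 + β₀ 1 - (d - (j₀ : ℕ)) + 1 : ℕ) : ℕ∞))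
    refine hord _ hSs (lt_of_le_of_lt (order_monicForm_le_of_coeff _ j₀ γ hγne) ?_)
    exact_mod_cast (by omega : γ.degree + (j₀ : ℕ) < d)

end WildMonic

end Summit.ResolutionOfSingularities.ResolutionOfSingularities.Theorems
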